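import Literature.NumberTheory.DiophantineGeometry.MinimalDiscriminantBaseChangeCongruence
import Literature.NumberTheory.EllipticCurves.Rank1Residual.CMFieldDecompositionProofs
import Literature.NumberTheory.EllipticCurves.ComplexMultiplicationDeuringInertiaNontrivialProofs
import Literature.NumberTheory.QuadraticFields.UnitsModCubes
import HarnessLib

/-!
# A curve over `ℚ` with `j = −3375` has bad reduction above `7` over every number field of degree `< 4`
# — proofs only

Topic `NumberTheory/EllipticCurves`.  THEOREMS ONLY (no definition, no named fact), from the tree's
base-change congruence `ord_w(Δ_min(E_K)) ≡ e(w∣p)·ord_p(Δ(E)) (mod 12)` (Silverman, *AEC* VII.1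
Remark 1.1 / Prop. 1.3, VII.5 Prop. 5.1 (a), Prop. 5.4 — tree
`WeierstrassCurve.not_hasGoodReductionAt_baseChange_of_odd_padicValRat_Δ_of_not_four_dvd`).

* `odd_padicValRat_seven_Δ_of_j_eq_neg3375` — for EVERY Weierstrass equation `W` over `ℚ` of an elliptic
  curve with `j = −3375` (the CM curves by `𝒪_{ℚ(√−7)}`: the twists of `49a1`, Silverman *Advanced
  Topics* App. A §3): `ord₇(Δ(W))` is ODD.  Indeed `c₆² = (j − 1728)·Δ = −5103·Δ = −3⁶·7·Δ`
  (`c₄³ = j·Δ`, `1728 Δ = c₄³ − c₆²`), so `2·ord₇(c₆) = 1 + ord₇(Δ)`.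
* `not_hasGoodReductionAt_baseChange_of_j_eq_neg3375` — hence for a number field `K` with
  `[K : ℚ] < 4` and a finite place `w ∋ 7` of `K` (so `e(w∣7) ∈ {1,2,3}`, `4 ∤ e`): the base change
  `W_K` does NOT have good reduction at `w`; `mem_badPlaces_baseChange_of_j_eq_neg3375`.
* `mem_badPlaces_baseChange_of_isCMFieldOfJ_of_discr_eq_neg_seven` — the same in the frame of the
  CM consumers: `W.j ∈ maximalCMJInvariants`, `IsCMFieldOfJ K W.j`, `discr K = −7` (then `W.j = −3375`
  by the table `IsCMFieldOfJ.discr_eq_cmFieldDiscrOfJ`, and `[K : ℚ] = 2`).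
* §4 ★ `exists_mem_greenbergInertia_not_mem_qDivisionFieldSubgroup_of_discr_eq_neg_seven` — the
  HYPOTHESIS-FREE door: in the Deuring frame over `K = ℚ(√−7)` (`discr K = −7`, `W.j ∈ maximalCMJInvariants`,
  `IsCMFieldOfJ K W.j`; Grössencharacter `ψ`; `p ≠ 7` split as `v v̄`), the place `w ∋ 7` of `K` is a
  bad place of `W_K` (§3) with `p ∉ w`, `𝒪_K^× = {±1}` (`d_K < −4`), so by
  `DeuringInertiaNontrivial.exists_mem_greenbergInertia_not_mem_qDivisionFieldSubgroup_of_mem_badPlaces`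
  some `τ ∈ GreenbergSelmer.inertia w` lies outside `Gal(K̄/K(E[q]))` — at `p = 2` exactly the
  hypothesis `hram` of the cell's `…UpsilonInertiaDoor`, now discharged modulo the Deuring print alone.

Consumer (cell `bsd-print-cf2`, crux `stmt-BirchSwinnertonDyer-20368`, class line «yager_twist_dictionary»,
(Q)-class recipe step (0)): the class input «`E′_K` is bad at `𝔩 = (√−7)`» of
`DeuringInertiaNontrivial.exists_mem_greenbergInertia_not_mem_qDivisionFieldSubgroup_of_mem_badPlaces`
(door «`E′[4]` ramified at an odd place» of `…UpsilonInertiaDoor`), for the good twists `E′` of the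
members (all with `j = −3375`, `K = ℚ(√−7)`).

## References

* [SilvermanAEC2009] J. H. Silverman, *The Arithmetic of Elliptic Curves*, 2nd ed. (2009), III.1
  (`c₄³ − c₆² = 1728Δ`, `j = c₄³/Δ`), VII.1 Remark 1.1 and Prop. 1.3, VII.5 Prop. 5.1 (a) and Prop. 5.4.
* [SilvermanATAEC1994] J. H. Silverman, *Advanced Topics in the Arithmetic of Elliptic Curves* (1994),
  App. A §3 (CM `j`-invariants: `j = −3375`, `d_K = −7`, conductor `49`).
* [Rubin1999] K. Rubin, *Elliptic curves with complex multiplication and the conjecture of Birch and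
  Swinnerton-Dyer*, LNM 1716 (1999), §5 Thm. 5.15 (i)–(iii), Cor. 5.5.
-/

noncomputable section

open scoped Classical

open NumberField IsDedekindDomain WeierstrassCurve Literature.NumberTheory.EllipticCurves
  Literature.NumberTheory.EllipticCurves.Rank1Residual Literature.NumberTheory.Automorphic
  Literature.NumberTheory.GaloisRepresentations

namespace Literature.NumberTheory.EllipticCurves.JNeg3375

/-! ## §1. `ord₇(Δ)` is odd for every equation with `j = −3375` -/

/-- **`ord₇(Δ(W))` is odd when `j(W) = −3375`** (any Weierstrass equation over `ℚ` of an elliptic curve):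
`c₆² = (j − 1728)·Δ = −3⁶·7·Δ`, so `2·ord₇(c₆) = 1 + ord₇(Δ)`.
[cite: SilvermanAEC2009, III.1 (c₄³ − c₆² = 1728Δ, j = c₄³/Δ)] [cite: SilvermanATAEC1994, App. A §3] -/
theorem odd_padicValRat_seven_Δ_of_j_eq_neg3375 (W : WeierstrassCurve ℚ) [W.IsElliptic]
    (hj : W.j = -3375) : Odd (padicValRat 7 W.Δ) := by
  haveI : Fact (Nat.Prime 7) := ⟨by norm_num⟩
  have hΔ : W.Δ ≠ 0 := by rw [← WeierstrassCurve.coe_Δ']; exact W.Δ'.ne_zero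
  -- `j · Δ = c₄³`
  have hjΔ : W.j * W.Δ = W.c₄ ^ 3 := by
    rw [WeierstrassCurve.j, ← WeierstrassCurve.coe_Δ', mul_assoc, mul_comm (W.c₄ ^ 3), ← mul_assoc,
      Units.inv_mul, one_mul]
  -- `c₆² = (j − 1728)·Δ = −5103·Δ`
  have hc6 : W.c₆ ^ 2 = -5103 * W.Δ := by
    have h := W.c_relation
    rw [hj] at hjΔ
    linear_combination h - hjΔ
  have hc6ne : W.c₆ ≠ 0 := by
    intro h0
    rw [h0, zero_pow two_ne_zero] at hc6
    have : (5103 : ℚ) * W.Δ = 0 := by linear_combination hc6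
    rcases mul_eq_zero.mp this with h | h
    · norm_num at h
    · exact hΔ h
  -- `ord₇(−5103) = 1`
  have h5103 : padicValRat 7 (-5103 : ℚ) = 1 := by
    rw [show (-5103 : ℚ) = -(((7 : ℕ) : ℚ) * ((729 : ℕ) : ℚ)) by norm_num, padicValRat.neg,
      padicValRat.mul (by norm_num) (by norm_num), padicValRat.self (by norm_num), padicValRat.of_nat,
      padicValNat.eq_zero_of_not_dvd (by norm_num)]
    norm_num
  have hval := congrArg (padicValRat 7) hc6
  rw [padicValRat.pow W.c₆, padicValRat.mul (by norm_num) hΔ, h5103] at hval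
  exact ⟨padicValRat 7 W.c₆ - 1, by push_cast at hval ⊢; omega⟩

/-! ## §2. Bad reduction above `7` after base change to a number field of degree `< 4` -/

/-- The place of `ℤ` at `7`. [folklore] -/
private theorem exists_place_seven :
    ∃ v : HeightOneSpectrum ℤ, Rat.HeightOneSpectrum.natGenerator v = 7 :=
  ⟨(Rat.HeightOneSpectrum.primesEquiv (R := ℤ)).symm ⟨7, by norm_num⟩,
    congrArg Subtype.val ((Rat.HeightOneSpectrum.primesEquiv (R := ℤ)).apply_symm_apply ⟨7, by norm_num⟩)⟩

/-- A finite place `w ∋ 7` of a number field lies over the place `(7)` of `ℤ`. [folklore] -/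
private theorem liesOver_of_seven_mem {K : Type*} [Field K] [NumberField K] (w : HeightOneSpectrum (𝓞 K))
    (hw : (7 : 𝓞 K) ∈ w.asIdeal) (v : HeightOneSpectrum ℤ)
    (hv : Rat.HeightOneSpectrum.natGenerator v = 7) : w.asIdeal.LiesOver v.asIdeal := by
  refine ⟨?_⟩
  rw [WeierstrassCurve.asIdeal_eq_span_natGenerator v, hv]
  have hmax : (Ideal.span {((7 : ℕ) : ℤ)}).IsMaximal :=
    PrincipalIdealRing.isMaximal_of_irreducible
      (by exact_mod_cast (Nat.prime_iff_prime_int.mp (by norm_num : Nat.Prime 7)).irreducible)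
  refine hmax.eq_of_le ?_ ?_
  · exact Ideal.IsPrime.ne_top (Ideal.IsPrime.under ℤ w.asIdeal)
  · rw [Ideal.span_le, Set.singleton_subset_iff]
    change algebraMap ℤ (𝓞 K) ((7 : ℕ) : ℤ) ∈ w.asIdeal
    simpa using hw

/-- **No good reduction above `7` for `j = −3375` over a number field of degree `< 4`.**  For an elliptic
curve over `ℚ` with `j = −3375` (any equation `W`), a number field `K` with `[K : ℚ] < 4` and a finite
place `w` of `K` with `7 ∈ w`: `W_K` does not have good reduction at `w` — `ord₇(Δ(W))` is odd and
`e(w∣7) ≤ [K : ℚ] < 4`, so `12 ∤ e(w∣7)·ord₇(Δ(W))`.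
[cite: SilvermanAEC2009, VII.5 Prop. 5.1 (a) and Prop. 5.4 (proof); VII.1 Remark 1.1] [cite: SilvermanATAEC1994, App. A §3] -/
theorem not_hasGoodReductionAt_baseChange_of_j_eq_neg3375 (W : WeierstrassCurve ℚ) [W.IsElliptic]
    (hj : W.j = -3375) (K : Type*) [Field K] [NumberField K] (hK : Module.finrank ℚ K < 4)
    (w : HeightOneSpectrum (𝓞 K)) (hw : (7 : 𝓞 K) ∈ w.asIdeal) :
    ¬ (W.baseChange K).HasGoodReductionAt w := by
  obtain ⟨v, hv⟩ := exists_place_seven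
  haveI : w.asIdeal.LiesOver v.asIdeal := liesOver_of_seven_mem w hw v hv
  haveI : v.asIdeal.IsMaximal := v.isMaximal
  haveI : w.asIdeal.IsPrime := w.isPrime
  have hodd : Odd (padicValRat (Rat.HeightOneSpectrum.natGenerator v) W.Δ) := by
    rw [hv]; exact odd_padicValRat_seven_Δ_of_j_eq_neg3375 W hj
  refine W.not_hasGoodReductionAt_baseChange_of_odd_padicValRat_Δ_of_not_four_dvd v K w hodd ?_
  have hle : v.asIdeal.ramificationIdx' w.asIdeal ≤ Module.finrank ℚ K :=
    Ideal.ramificationIdx_le_finrank (S := 𝓞 K) ℚ K w.asIdeal (p := v.asIdeal)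
  have hne : v.asIdeal.ramificationIdx' w.asIdeal ≠ 0 :=
    Ideal.IsDedekindDomain.ramificationIdx'_ne_zero_of_liesOver w.asIdeal v.ne_bot
  intro h4
  have := Nat.le_of_dvd (Nat.pos_of_ne_zero hne) h4
  omega

/-- `w ∈ badPlaces (W_K)` form of `not_hasGoodReductionAt_baseChange_of_j_eq_neg3375`.
[cite: SilvermanAEC2009, VII.5 Prop. 5.1 (a) and Prop. 5.4 (proof)] [cite: SilvermanATAEC1994, App. A §3] -/
theorem mem_badPlaces_baseChange_of_j_eq_neg3375 (W : WeierstrassCurve ℚ) [W.IsElliptic]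
    (hj : W.j = -3375) (K : Type*) [Field K] [NumberField K] (hK : Module.finrank ℚ K < 4)
    (w : HeightOneSpectrum (𝓞 K)) (hw : (7 : 𝓞 K) ∈ w.asIdeal) :
    w ∈ (W.baseChange K).badPlaces (𝓞 K) :=
  (WeierstrassCurve.mem_badPlaces_iff (W.baseChange K) w).mpr
    (not_hasGoodReductionAt_baseChange_of_j_eq_neg3375 W hj K hK w hw)

/-! ## §3. The CM consumers' frame: `j ∈ maximalCMJInvariants`, `IsCMFieldOfJ K j`, `discr K = −7` -/

/-- In the maximal-order table, CM discriminant `−7` means `j = −3375`. [cite: SilvermanATAEC1994, App. A §3] -/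
theorem j_eq_neg3375_of_mem_maximalCMJInvariants_of_cmFieldDiscrOfJ_eq {j : ℚ}
    (hjm : j ∈ maximalCMJInvariants) (h7 : cmFieldDiscrOfJ j = -7) : j = -3375 := by
  simp only [maximalCMJInvariants, Finset.mem_insert, Finset.mem_singleton] at hjm
  rcases hjm with rfl | rfl | rfl | rfl | rfl | rfl | rfl | rfl | rfl <;>
    first | rfl | (exfalso; revert h7; norm_num [cmFieldDiscrOfJ])

/-- **The CM consumers' form**: `E/ℚ` with CM by the maximal order of `K` (`W.j ∈ maximalCMJInvariants`,
`IsCMFieldOfJ K W.j`) and `discr K = −7` — i.e. `K = ℚ(√−7)`, `j = −3375` — has bad reduction at every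
place `w ∋ 7` of `K` (`w = 𝔩 = (√−7)`): `w ∈ badPlaces (W_K)`.
[cite: SilvermanAEC2009, VII.5 Prop. 5.1 (a) and Prop. 5.4 (proof)] [cite: SilvermanATAEC1994, App. A §3] -/
theorem mem_badPlaces_baseChange_of_isCMFieldOfJ_of_discr_eq_neg_seven (W : WeierstrassCurve ℚ)
    [W.IsElliptic] (hjm : W.j ∈ maximalCMJInvariants) (K : Type) [Field K] [NumberField K]
    (hK : IsCMFieldOfJ K W.j) (hdK : NumberField.discr K = -7)
    (w : HeightOneSpectrum (𝓞 K)) (hw : (7 : 𝓞 K) ∈ w.asIdeal) :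
    w ∈ (W.baseChange K).badPlaces (𝓞 K) := by
  have h7 : cmFieldDiscrOfJ W.j = -7 := by rw [← hK.discr_eq_cmFieldDiscrOfJ hjm, hdK]
  exact mem_badPlaces_baseChange_of_j_eq_neg3375 W
    (j_eq_neg3375_of_mem_maximalCMJInvariants_of_cmFieldDiscrOfJ_eq hjm h7) K (by rw [hK.1]; norm_num) w hw

/-! ## §4. The hypothesis-free door over `K = ℚ(√−7)` -/

/-- A number field has a finite place containing `7` (`7` is not a unit of `𝓞 K`: its norm is
`7^{[K:ℚ]} ≠ ±1`). [folklore] -/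
private theorem exists_seven_mem_asIdeal (K : Type) [Field K] [NumberField K] :
    ∃ w : HeightOneSpectrum (𝓞 K), (7 : 𝓞 K) ∈ w.asIdeal := by
  have hnu : ¬ IsUnit ((7 : 𝓞 K)) := fun h => by
    have h1 := h.map (Algebra.norm ℤ)
    rw [show (7 : 𝓞 K) = algebraMap ℤ (𝓞 K) 7 by simp, Algebra.norm_algebraMap, Int.isUnit_iff_natAbs_eq,
      Int.natAbs_pow] at h1
    exact (Nat.one_lt_pow (Module.finrank_pos (R := ℤ) (M := 𝓞 K)).ne' (by norm_num)).ne' h1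
  obtain ⟨M, hM, hle⟩ := Ideal.exists_le_maximal (Ideal.span {(7 : 𝓞 K)})
    (by rwa [Ne, Ideal.span_singleton_eq_top])
  refine ⟨⟨M, hM.isPrime, fun hbot => ?_⟩, hle (Ideal.mem_span_singleton_self _)⟩
  have h := hle (Ideal.mem_span_singleton_self _)
  rw [hbot, Ideal.mem_bot] at h
  norm_num at h

/-- Two distinct rational primes do not lie in the same finite place. [folklore] -/
private theorem natCast_not_mem_of_seven_mem {K : Type} [Field K] [NumberField K]
    (w : HeightOneSpectrum (𝓞 K)) (hw : (7 : 𝓞 K) ∈ w.asIdeal) {p : ℕ} (hp : p.Prime) (hp7 : p ≠ 7) :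
    ((p : ℕ) : 𝓞 K) ∉ w.asIdeal := by
  intro hpw
  have hcop : IsCoprime ((p : ℤ) : 𝓞 K) ((7 : ℤ) : 𝓞 K) :=
    (Nat.isCoprime_iff_coprime.mpr ((Nat.coprime_primes hp (by norm_num)).mpr hp7)).map
      (algebraMap ℤ (𝓞 K))
  obtain ⟨a, b, hab⟩ := hcop
  refine w.isPrime.ne_top ((Ideal.eq_top_iff_one _).mpr ?_)
  rw [← hab]
  refine Ideal.add_mem _ (Ideal.mul_mem_left _ _ ?_) (Ideal.mul_mem_left _ _ ?_)
  · simpa using hpw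
  · simpa using hw

/-- ★ **The hypothesis-free door over `K = ℚ(√−7)`.**  In the frame of the Deuring split print
(`hDG`; `E/ℚ` globally minimal with `W.j ∈ maximalCMJInvariants`, CM field `K` with `IsCMFieldOfJ K W.j`
and `discr K = −7`, complex conjugation `c ≠ 1`, Grössencharacter `ψ` of type `(1,0)`, `c`-equivariant,
`L(ψ,s) = L(E,s)`; a prime `p ≠ 7` split as `v v̄`): there is a finite place `w` of `K` with `p ∉ w`
(namely `w ∋ 7`, where `E_K` has bad reduction, §3) and an element `τ` of the inertia group
`GreenbergSelmer.inertia w` that does NOT fix `E_K[q]` pointwise (`q = 4` at `p = 2`, `q = p` otherwise).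
At `p = 2` this is the hypothesis `hram` («`E′[4]` is ramified at an odd place») of the cell's
`…UpsilonInertiaDoor`, discharged modulo the print. [cite: Rubin1999, §5 Thm. 5.15 (ii)–(iii) (proof, PDF p. 231), Cor. 5.5]
[cite: SilvermanAEC2009, Thm. VII.7.1; VII.5 Prop. 5.1 (a), Prop. 5.4] [cite: SilvermanATAEC1994, App. A §3] -/
theorem exists_mem_greenbergInertia_not_mem_qDivisionFieldSubgroup_of_discr_eq_neg_seven
    (hDG : Deuring_galoisAction_cmPrimaryTorsion_split)
    (W : WeierstrassCurve ℚ) [W.IsElliptic] [W.IsGloballyMinimal] (hjm : W.j ∈ maximalCMJInvariants)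
    (K : Type) [Field K] [NumberField K] (hK : IsCMFieldOfJ K W.j) (hdK : NumberField.discr K = -7)
    (c : K ≃ₐ[ℚ] K) (hc : c ≠ 1) (ψ : HeckeCharacter K)
    (hψ : ψ.HasInfinityType (fun _ ↦ 1) (fun _ ↦ 0)) (hψc : IsHeckeConjEquivariant c ψ)
    (hL : ∀ s : ℂ, 3 / 2 < s.re → heckeLFunction ψ s = W.LSeries s)
    (p : ℕ) [Fact p.Prime] (hp7 : p ≠ 7) (v vbar : HeightOneSpectrum (𝓞 K))
    (hv : ((p : ℕ) : 𝓞 K) ∈ v.asIdeal) (hvbar : ((p : ℕ) : 𝓞 K) ∈ vbar.asIdeal) (hne : vbar ≠ v) :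
    ∃ w : HeightOneSpectrum (𝓞 K), ((p : ℕ) : 𝓞 K) ∉ w.asIdeal ∧
      ∃ τ ∈ GreenbergSelmer.inertia w, τ ∉ (W.baseChange K).qDivisionFieldSubgroup p := by
  obtain ⟨w, hw7⟩ := exists_seven_mem_asIdeal K
  have hpw : ((p : ℕ) : 𝓞 K) ∉ w.asIdeal := natCast_not_mem_of_seven_mem w hw7 Fact.out hp7
  obtain ⟨T⟩ := Literature.NumberTheory.QuadraticFields.Quadratic.nonempty_tauData (K := K) hK.1
  have hunits : ∀ u : 𝓞 K, IsUnit u → u = 1 ∨ u = -1 := fun u hu ↦ by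
    obtain ⟨u', rfl⟩ := hu
    exact Literature.NumberTheory.QuadraticFields.Quadratic.TauData.units_eq_one_or_neg_one T hK.1
      (by rw [hdK]; norm_num) u'
  exact ⟨w, hpw,
    DeuringInertiaNontrivial.exists_mem_greenbergInertia_not_mem_qDivisionFieldSubgroup_of_mem_badPlaces
      hDG W hjm K hK c hc ψ hψ hψc hL p v vbar hv hvbar hne hunits hpw
      (mem_badPlaces_baseChange_of_isCMFieldOfJ_of_discr_eq_neg_seven W hjm K hK hdK w hw7)⟩

end Literature.NumberTheory.EllipticCurves.JNeg3375

end
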